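import Literature.AlgebraicGeometry.Shioda1982.ExceptionalQuadruplesComplete
import HarnessLib

/-!
# Shioda 1982 / Meyer–Neutsch 1981: no exceptional quadruple at the level `N = 264` — kernel sweep, part 1 of 2

Topic `Literature/AlgebraicGeometry/Shioda1982`; companion of `ExceptionalQuadruplesComplete.lean` (search `checkB`, soundness
`tabelleOneCompleteAt_of_chunks`, invariant form `exists_mem_reps_of_isExceptionalQuadruple`, statement `TabelleOneCompleteAt`; sources,
method and framing in its module docstring) and of the series `ExceptionalQuadruplesSweep*.lean` (together: every level `2 ≤ N ≤ 180`
that is not a row of Tabelle 1; `…SweepTwoHundredTwenty.lean`: `N = 220`). THEOREMS only (no definition, no named fact): the same kernel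
search at the single level `N = 264`, which carries NO row of [MeyerNeutsch1981Fermatquadrupel, Tabelle 1] (computer-generated there,
"alle Fermatquadrupel für N ≤ 614 ermittelt", §2 p. 53) and lies above the range `N ≤ 180` of Shioda's table p. 727 — by Aoki's
Theorem C ([Aoki1983], computer-assisted for `181 ≤ m ≤ 672`) there is no exceptional element at any level `> 180`; the files
`ExceptionalQuadruplesSweepTwoHundredSixtyFourPartOne.lean`, `ExceptionalQuadruplesSweepTwoHundredSixtyFour.lean` make the instance `N = 264` a kernel statement. The search at
`N = 264` visits 519838 candidate triples (`φ(264) − 1 = 79` units each), too many for one elaboration of bounded wall time, so the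
chunks of first entries are spread over 2 files: `ExceptionalQuadruplesSweepTwoHundredSixtyFourPartOne.lean` — first entries `0 ≤ a < 39` (242419 candidates);
`ExceptionalQuadruplesSweepTwoHundredSixtyFour.lean` — first entries `39 ≤ a < 264` (277419 candidates); the last one assembles
`completeAt_twoHundredSixtyFour` (every sorted pair-free primitive Hodge 4-multiset mod `264` is standard) and `not_isExceptionalQuadruple_twoHundredSixtyFour`.
WHY THIS LEVEL (cell `pub-hfermat`): `264 = 24·11`, the instance `p = 11` of the family `m = 24p` of
`HodgeQuadruplesTwentyFourPrime.lean` (`classify_hodgeMultiset_twentyFourPrime`, `p ≥ 17`) below its range — a residual prime of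
`PicardNumberTwentyFourPrime.lean` (`exceptional_twentyFourPrime_ne_seven`). `decide +kernel` only (no `native_decide`).

HONEST FRAMING (cell `pub-hfermat`): explicit algebraic cycles for specific Hodge classes on Fermat/Delsarte varieties; residual open
instances listed; no claim on general Hodge. These classes are algebraic (Lefschetz (1,1)); certified here is only the emptiness of the
exceptional list at this level.

## References
* [MeyerNeutsch1981Fermatquadrupel] W. Meyer, W. Neutsch, *Fermatquadrupel*, Math. Ann. 256 (1981) 51–62, §2 p. 53, Tabelle 1 p. 54 (no row 264).
* [Shioda1982PicardFermat] T. Shioda, J. Fac. Sci. Univ. Tokyo IA 28 (1982) 725–734, table p. 727 (levels `≤ 180`), Prop. 4 (Q′) p. 729.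
* [Aoki1983] N. Aoki, Math. Ann. 266 (1983) 23–54, Thm. C.
-/

namespace Literature.AlgebraicGeometry.Shioda1982

open Literature.AlgebraicGeometry.HodgeTheory

set_option maxHeartbeats 0 in
/-- **The search at `N = 264` passes on the first entries `0 ≤ a < 39`** (part 1 of 2: 13 chunks, 242419 candidate
triples): every visited sorted quadruple of representatives there fails the Hodge test or is standard (`checkB`; `reps 264 = []`).
[cite: MeyerNeutsch1981Fermatquadrupel, §2 p. 53 ("alle Fermatquadrupel für N ≤ 614 ermittelt") and Tabelle 1 p. 54 (no row 264)]
[cite: Aoki1983, Thm. C] -/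
theorem checkB_twoHundredSixtyFour_partOne :
    ∀ p ∈ ([(0, 3), (3, 3), (6, 3), (9, 3), (12, 3), (15, 3), (18, 3), (21, 3), (24, 3), (27, 3), (30, 3), (33, 3), (36, 3)] : List (ℕ × ℕ)), checkB 264 p.1 p.2 = true := by
  intro p hp
  simp only [List.mem_cons, List.not_mem_nil, or_false] at hp
  rcases hp with rfl | rfl | rfl | rfl | rfl | rfl | rfl | rfl | rfl | rfl | rfl | rfl | rfl <;> decide +kernel

end Literature.AlgebraicGeometry.Shioda1982
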